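import Literature.MathematicalPhysics.QuantumFieldTheory.TomboulisYaffeInequality
import HarnessLib

/-!
# Crux `IR` (stmt-QuantumFields-19354), line `tension-ratio` (flux skeleton), stub `TYObservable` — part 3a:
# helpers for Tomboulis–Yaffe (A1.8) with an OBSERVABLE representation (twist observables, stack moves, probe traces)

Pooled prover `ym-ir-line-pool-p3` (gen 3).  Helper module for item `stmt-QuantumFields-19354` (`--supports`; it closes
nothing).  Port of the tree theorem `TomboulisYaffe.polyakovCorrelator_half_normSq_le_twist`
(`Literature/…/TomboulisYaffeTwistBound.lean`) to Polyakov loops taken in a PROBE representation `π` carrying the centre charge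
(`π(z) = ω · 1`, `|ω| = 1`) while the twist and the measure are those of the action's representation `ρ` (any continuous `ρ`, any
central `z`, no scalar condition on `ρ(z)`):

  `|1 - ω|² · |⟨tr π(Πⱼ(0)) · conj tr π(Πⱼ((L/2) e₀))⟩_{ρ,β}|² ≤ 8 M⁴ (1 - Z_ρ(z; (0,j)) / Z_ρ(1; (0,j)))`.

The proof is the tree's verbatim: the stack-moving substitution is a property of the `ρ`-measure (`integral_mul_exp_stack_succ`,
`wilsonExpectation_twistObs`, `wilsonExpectation_twistObs_inv_mul_twistObs`, `twistObs_negReflect`), and the probe enters only through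
`tr π(z g) = ω tr π(g)`.  The measure-side private helpers of the tree file are re-proved here (§1); everything is proved; no new
definitions; nothing here bears on the Yang–Mills mass gap.  [cite: TomboulisYaffe1985, App. I §C eq. (A1.8)]
-/

open MeasureTheory Finset Complex
open scoped ComplexOrder ComplexConjugate

noncomputable section

namespace Summit.QuantumFields.YangMills.Cruxes.IR.TensionRatio.FluxTY

open Literature.MathematicalPhysics.QuantumFieldTheory Literature.MathematicalPhysics.QuantumFieldTheory.TomboulisYaffe
open WilsonRP WilsonSiteRP Literature.RepresentationTheory.CompactGroups

variable {d L N M : ℕ} [NeZero d] [NeZero L] {G : Type*} [Group G] [TopologicalSpace G]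
  [IsTopologicalGroup G] [CompactSpace G] [MeasurableSpace G] [BorelSpace G]
  (ρ : G →* Matrix (Fin N) (Fin N) ℂ) (π : G →* Matrix (Fin M) (Fin M) ℂ)

/-! ## §1 Measure-side helpers (copies of the tree's private lemmas) -/

section Helpers

omit [NeZero d] in
/-- `⟨f⟩_{Λ,β} = Z₁⁻¹ ∫ exp(-β S(U)) f(U) ∏ dU_e` with `Z₁ = ∫ exp(-β S) ∏ dU_e` the untwisted
partition function (a real number, `insertedPartitionFunction ρ β L 1`). [folklore] -/
theorem wilsonExpectation_eq_smul_integral (hρ : Continuous ρ) (β : ℝ)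
    (f : GaugeConfig d L G → ℂ) :
    wilsonExpectation ρ β f =
      (insertedPartitionFunction ρ β L (fun _ : Plaquette d L => (1 : G)))⁻¹ •
        ∫ U : GaugeConfig d L G, (Real.exp (-β * wilsonAction ρ U) : ℂ) * f U
          ∂(Measure.pi fun _ : Edge d L => haarProbability G) := by
  have hdens : Measurable fun U : GaugeConfig d L G =>
      ENNReal.ofReal (Real.exp (-β * wilsonAction ρ U)) :=
    ENNReal.measurable_ofReal.comp ((WilsonRP.measurable_wilsonAction ρ hρ).const_mul (-β)).exp
  unfold wilsonExpectation wilsonMeasure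
  rw [integral_smul_measure, insertedPartitionFunction_one ρ hρ β, ENNReal.toReal_inv]
  unfold wilsonWeight
  rw [integral_withDensity_eq_integral_toReal_smul hdens (ae_of_all _ fun _ => ENNReal.ofReal_lt_top)]
  simp_rw [ENNReal.toReal_ofReal (Real.exp_nonneg _), Complex.real_smul]

omit [NeZero d] in
/-- The expectation of `f · exp(β(S - S_t))` is `Z₁⁻¹ ∫ f exp(-β S_t)`: inserting the twist
observable replaces the Boltzmann weight by the twisted one. [folklore] -/
theorem wilsonExpectation_mul_twistObs (hρ : Continuous ρ) (β : ℝ) (t : Plaquette d L → G)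
    (f : GaugeConfig d L G → ℂ) :
    wilsonExpectation ρ β (fun U : GaugeConfig d L G =>
        f U * (Real.exp (β * (wilsonAction ρ U - insertedWilsonAction ρ t U)) : ℂ)) =
      (insertedPartitionFunction ρ β L (fun _ : Plaquette d L => (1 : G)))⁻¹ •
        ∫ U : GaugeConfig d L G, f U * (Real.exp (-(β * insertedWilsonAction ρ t U)) : ℂ)
          ∂(Measure.pi fun _ : Edge d L => haarProbability G) := by
  rw [wilsonExpectation_eq_smul_integral ρ hρ β]
  congr 1
  refine integral_congr_ae (ae_of_all _ fun U => ?_)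
  have hexp : -β * wilsonAction ρ U + β * (wilsonAction ρ U - insertedWilsonAction ρ t U) =
      -(β * insertedWilsonAction ρ t U) := by ring
  show ((Real.exp (-β * wilsonAction ρ U) : ℝ) : ℂ) *
      (f U * (Real.exp (β * (wilsonAction ρ U - insertedWilsonAction ρ t U)) : ℂ)) =
    f U * (Real.exp (-(β * insertedWilsonAction ρ t U)) : ℂ)
  rw [mul_left_comm, ← Complex.ofReal_mul, ← Real.exp_add, hexp]

omit [NeZero L] [TopologicalSpace G] [IsTopologicalGroup G] [CompactSpace G] [MeasurableSpace G]
  [BorelSpace G] in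
/-- A straight line in direction `j` based outside the time slice carrying the substitution is
unchanged by `U ↦ cU`. [folklore] -/
theorem lineHolonomy_stackMove_of_ne {j : Fin d} (hj : j ≠ 0) (z : G) (a b : ZMod L)
    (U : GaugeConfig d L G) (n : ℕ) (y : Site d L) (hy : y 0 ≠ a + 1) :
    lineHolonomy ((fun e : Edge d L => if e.2 = j ∧ e.1 0 = a + 1 ∧ e.1 j = b then z⁻¹ else 1) * U)
        j n y = lineHolonomy U j n y := by
  refine WilsonLoopRP.lineHolonomy_congr j n y fun s _ => ?_
  rw [Pi.mul_apply]
  dsimp only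
  rw [if_neg, one_mul]
  rintro ⟨-, h0, -⟩
  exact hy (by simpa [Pi.single_eq_of_ne hj.symm] using h0)

omit [NeZero L] [TopologicalSpace G] [IsTopologicalGroup G] [CompactSpace G] [MeasurableSpace G]
  [BorelSpace G] in
/-- **A Polyakov loop crossing the moved stack picks up the central element**: the closed line of
`L` links in direction `j` through the point `y` of the substituted time slice with `y_j = b` meets
exactly one substituted link, so its holonomy is multiplied by `z⁻¹` (TY: the change of variables
"changes the sign" of `tr Ω[0]`; Kanazawa (19): `W_R(C) → z^{±N(R)k} W_R(C)`). [folklore] -/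
theorem lineHolonomy_stackMove_of_eq [Fact (1 < L)] {j : Fin d} {z : G} (a b : ZMod L)
    (U : GaugeConfig d L G) (y : Site d L) (hy0 : y 0 = a + 1) (hyj : y j = b) :
    lineHolonomy ((fun e : Edge d L => if e.2 = j ∧ e.1 0 = a + 1 ∧ e.1 j = b then z⁻¹ else 1) * U)
        j L y = z⁻¹ * lineHolonomy U j L y := by
  set c : Edge d L → G := fun e => if e.2 = j ∧ e.1 0 = a + 1 ∧ e.1 j = b then z⁻¹ else 1 with hc
  have h1L : 1 < L := Fact.out
  have hL1 : L = (L - 1) + 1 := by omega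
  have step : ∀ V : GaugeConfig d L G, lineHolonomy V j L y = lineHolonomy V j ((L - 1) + 1) y :=
    fun V => congrArg (fun n => lineHolonomy V j n y) hL1
  rw [step, step, lineHolonomy, lineHolonomy, Pi.mul_apply]
  have hhead : c (y, j) = z⁻¹ := by rw [hc]; dsimp only; rw [if_pos ⟨rfl, hy0, hyj⟩]
  have htail : lineHolonomy (c * U) j (L - 1) (y.shift j) = lineHolonomy U j (L - 1) (y.shift j) := by
    refine WilsonLoopRP.lineHolonomy_congr j (L - 1) _ fun s hs => ?_
    rw [Pi.mul_apply, hc]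
    dsimp only
    rw [if_neg, one_mul]
    rintro ⟨-, -, hb⟩
    have hval : (y.shift j + Pi.single j ((s : ℕ) : ZMod L) : Site d L) j = b + ((s + 1 : ℕ) : ZMod L) := by
      simp only [Site.shift, Pi.add_apply, Pi.single_eq_same, hyj]
      push_cast; ring
    rw [hval, add_eq_left] at hb
    have := (ZMod.natCast_eq_zero_iff _ _).1 hb
    exact absurd (Nat.le_of_dvd (by omega) this) (by omega)
  rw [hhead, htail, mul_assoc]

omit [NeZero d] [MeasurableSpace G] [BorelSpace G] in
/-- Crude uniform bound on a twist observable: `|exp(β(S - S_t))| ≤ exp(2|β| · 2N · #plaquettes)`.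
[folklore] -/
theorem norm_twistObs_le (hρ : Continuous ρ) (β : ℝ) (t : Plaquette d L → G)
    (U : GaugeConfig d L G) :
    ‖((Real.exp (β * (wilsonAction ρ U - insertedWilsonAction ρ t U)) : ℝ) : ℂ)‖ ≤
      Real.exp (2 * (|β| * (2 * N * Fintype.card (Plaquette d L)))) := by
  rw [Complex.norm_real, Real.norm_eq_abs, abs_of_pos (Real.exp_pos _)]
  refine Real.exp_le_exp.2 ?_
  have key : ∀ s : Plaquette d L → G,
      |β * insertedWilsonAction ρ s U| ≤ |β| * (2 * N * Fintype.card (Plaquette d L)) := fun s => by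
    rw [abs_mul]
    exact mul_le_mul_of_nonneg_left (abs_insertedWilsonAction_le ρ hρ s U) (abs_nonneg _)
  have h1 := (le_abs_self _).trans (key fun _ => 1)
  have h2 := (neg_le_abs _).trans (key t)
  rw [insertedWilsonAction_one] at h1
  rw [mul_sub]
  linarith

section HalfObs

variable [Fact (1 < L)]

/-- **The twist observable of a stack in the first time slab is an admissible half-observable**:
`U ↦ exp(β(S(U) - S_{w,(0,b)}(U)))` depends only on the links of the plaquettes of the stack
`{x₀ = 0, x_j = b}`, which lie in the closed positive half, and is bounded (the step "F is an
observable of the links of the stack plaquettes" of `twistedPartitionFunction_le_untwisted`).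
[folklore] -/
theorem isHalfObs_twistObs (hL : Even L) (hρ : Continuous ρ) (β : ℝ) (w : G) {j : Fin d}
    (hj : (0 : Fin d) < j) (b : ZMod L) (κ : ℂ) :
    IsHalfObs (fun U : GaugeConfig d L G => κ - (Real.exp (β * (wilsonAction ρ U -
      insertedWilsonAction ρ (stackInsertion w ⟨(0, j), hj⟩ 0 b) U)) : ℂ)) := by
  set t := stackInsertion w ⟨((0 : Fin d), j), hj⟩ (0 : ZMod L) b with ht
  have hFr : Measurable fun U : GaugeConfig d L G =>
      Real.exp (β * (wilsonAction ρ U - insertedWilsonAction ρ t U)) :=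
    Real.measurable_exp.comp (((WilsonRP.measurable_wilsonAction ρ hρ).sub
      (measurable_insertedWilsonAction ρ hρ t)).const_mul β)
  have hE : ∀ e : Edge d L, IsSitePosEdge e ∨ IsSharedEdge e →
      e ∈ ((sitePosEdges ∪ sharedEdges : Finset (Edge d L)) : Set (Edge d L)) := fun e he => by
    rw [Finset.coe_union, Set.mem_union, Finset.mem_coe, Finset.mem_coe, mem_sitePosEdges,
      mem_sharedEdges]
    exact he
  refine ⟨Complex.measurable_ofReal.comp hFr |>.const_sub κ,
    ⟨‖κ‖ + Real.exp (2 * (|β| * (2 * N * Fintype.card (Plaquette d L)))),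
    fun U => (norm_sub_le _ _).trans (add_le_add le_rfl (norm_twistObs_le ρ hρ β t U))⟩,
    fun U V hUV => ?_⟩
  · suffices h : wilsonAction ρ U - insertedWilsonAction ρ t U =
        wilsonAction ρ V - insertedWilsonAction ρ t V by
      simp only [h]
    rw [← insertedWilsonAction_one ρ U, ← insertedWilsonAction_one ρ V]
    unfold insertedWilsonAction
    rw [← Finset.sum_sub_distrib, ← Finset.sum_sub_distrib]
    refine Finset.sum_congr rfl fun p _ => ?_
    by_cases hp : p.2 = ⟨((0 : Fin d), j), hj⟩ ∧ p.1 0 = 0 ∧ p.1 j = b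
    · have htp : t p = w := if_pos hp
      have hpos : IsSitePosPlaq p := by
        have h1 : p.2.1.1 = 0 := by rw [hp.1]
        unfold IsSitePosPlaq
        rw [if_pos h1, hp.2.1, ZMod.val_zero]
        have : 1 < L := Fact.out
        omega
      obtain ⟨e1, e2, e3, e4⟩ := edges_of_isSitePosPlaq hL hpos
      have u1 := hUV _ (hE _ e1)
      have u2 := hUV _ (hE _ e2)
      have u3 := hUV _ (hE _ e3)
      have u4 := hUV _ (hE _ e4)
      simp only [htp, plaquetteHolonomy, u1, u2, u3, u4]
    · have htp : t p = 1 := if_neg hp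
      simp [htp]

end HalfObs

end Helpers

/-! ## §2 Observable-side helpers -/

section ObsHelpers

omit [NeZero d] [NeZero L] [MeasurableSpace G] [BorelSpace G] in
/-- `‖tr π(g)‖ ≤ M` for a continuous representation of a compact group. -/
theorem norm_trace_le_dim (hπ : Continuous π) (g : G) : ‖(π g).trace‖ ≤ M := by
  rw [← CompactGroup.trace_unitarize π hπ, Matrix.trace]
  refine (norm_sum_le _ _).trans ?_
  calc ∑ k, ‖Matrix.diag (CompactGroup.unitarize π hπ g) k‖ ≤ ∑ _k : Fin M, (1 : ℝ) :=
        Finset.sum_le_sum fun k _ => CompactGroup.norm_unitarize_apply_le_one π hπ g k k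
    _ = M := by simp

omit [NeZero d] [NeZero L] [TopologicalSpace G] [IsTopologicalGroup G] [CompactSpace G]
  [MeasurableSpace G] [BorelSpace G] in
/-- A central element acting as the scalar `ω` in `π` multiplies `π`-traces by `ω`. -/
theorem trace_central_mul {z : G} {ω : ℂ} (hω : π z = ω • (1 : Matrix (Fin M) (Fin M) ℂ))
    (g : G) : (π (z * g)).trace = ω * (π g).trace := by
  rw [map_mul, hω, Matrix.smul_mul, Matrix.one_mul, Matrix.trace_smul, smul_eq_mul]

omit [NeZero d] [NeZero L] [TopologicalSpace G] [IsTopologicalGroup G] [CompactSpace G]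
  [MeasurableSpace G] [BorelSpace G] in
/-- If `π(z) = ω · 1` with `ω ≠ 0` then `π(z⁻¹) = ω⁻¹ · 1`. -/
theorem map_inv_eq_smul {z : G} {ω : ℂ} (hω0 : ω ≠ 0)
    (hω : π z = ω • (1 : Matrix (Fin M) (Fin M) ℂ)) :
    π z⁻¹ = ω⁻¹ • (1 : Matrix (Fin M) (Fin M) ℂ) := by
  have h1 : π z⁻¹ * π z = 1 := by rw [← map_mul, inv_mul_cancel, map_one]
  calc π z⁻¹ = π z⁻¹ * π z * (ω⁻¹ • (1 : Matrix (Fin M) (Fin M) ℂ)) := by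
        rw [Matrix.mul_assoc, hω, Matrix.smul_mul, Matrix.one_mul, smul_smul, mul_inv_cancel₀ hω0,
          one_smul, Matrix.mul_one]
    _ = ω⁻¹ • (1 : Matrix (Fin M) (Fin M) ℂ) := by rw [h1, Matrix.one_mul]

end ObsHelpers

end Summit.QuantumFields.YangMills.Cruxes.IR.TensionRatio.FluxTY

end
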